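import Literature.Barriers.CriticalPhenomena.GridSAWStructuredDrawingCompose
import HarnessLib

/-!
# The grid drawing of the graph of a formula, I: vocabulary of stamps and the finite checks

Support for the grid drawing `E₀` (Liśkiewicz–Ogihara–Toda 2003, proof of Theorem 7) of the graph of
a formula (`Literature/Combinatorics/SimpleGraph/GridFormula*.lean`), which is assembled in
`GridSAWFormulaDrawing.lean` from translated copies of finitely many STAMPS (the kinds of
`GridSAWFormulaStamps.lean`). This file fixes the vocabulary the generated tables are written in and
the Boolean checks run on them by `decide`:

* `Ref` — a reference to a vertex of an object anchored at a tile at offset `(di, dj)`: a cell vertex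
  (`cell di dj c l`, `l = 0` the connector, `l = v + 1` block vertex `v` of the cell at position `c`)
  or a gadget vertex (`gad di dj f idx`: vertex `idx` of the gadget of family code `f`);
* `RowClass`, `TK` — attributes of kinds used by the realisability filter;
* `poly` — the rectilinear grid path through a list of corner points (`isChain_poly`), `interior`;
* `inCseg a b` (the closed box spanned by two points: the segment, for axis-parallel ends),
  `mem_poly_exists` (every point of `poly ws` lies on the box of two consecutive corners),
  `csegMeetB` / `csegMeet_sub` (the points common to two boxes lie in a given finite list — the
  constant-time test all congestion checks reduce to);
* `shiftPt` (translation), `inBoxB` (bounding boxes).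

## References

* M. Liśkiewicz, M. Ogihara, S. Toda, TCS 304 (2003) 129–156, §4 (proof of Theorem 7).
-/

namespace Literature.Barriers.CriticalPhenomena.GridSAW.FormulaDrawing

/-! ### References and attributes -/

/-- **A reference to a vertex of a nearby object**, relative to the anchor tile of the referring
object. [folklore] -/
inductive Ref
  | cell (di dj : ℤ) (c : ℕ) (l : ℕ)
  | gad (di dj : ℤ) (f : ℕ) (idx : ℕ)
  deriving DecidableEq, Repr

/-- Row class of a kind. [folklore] -/
inductive RowClass
  | tile
  | clause
  deriving DecidableEq, Repr

/-- Tile-kind class of a kind (`e`/`t`/`c`: empty/tap/cross tiles; `b`: one-bit cells shared by empty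
and tap tiles; `et`: chords shared by empty and tap tiles; `k`: clause row; `d`: the doubling cell).
[folklore] -/
inductive TK
  | e | t | c | b | et | k | d
  deriving DecidableEq, Repr

/-- Compatibility of tile-kind classes of two objects anchored at the same tile. [folklore] -/
def TK.compat : TK → TK → Bool
  | .e, .e | .t, .t | .c, .c | .b, .b | .et, .et | .k, .k | .d, .d => true
  | .b, .e | .e, .b | .b, .t | .t, .b | .b, .et | .et, .b | .e, .et | .et, .e | .t, .et | .et, .t => true
  | .d, .b | .b, .d => true
  | _, _ => false

/-! ### Rectilinear paths -/

/-- The unit-step segment from `p` towards `q` along the first coordinate, then the second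
(excluding `p`, including `q`). [folklore] -/
def seg (p q : GridPoint) : List GridPoint :=
  let xs : List GridPoint :=
    if p.1 ≤ q.1 then (List.range (q.1 - p.1).toNat).map fun n => (p.1 + (n + 1 : ℕ), p.2)
    else (List.range (p.1 - q.1).toNat).map fun n => (p.1 - (n + 1 : ℕ), p.2)
  let ys : List GridPoint :=
    if p.2 ≤ q.2 then (List.range (q.2 - p.2).toNat).map fun n => (q.1, p.2 + (n + 1 : ℕ))
    else (List.range (p.2 - q.2).toNat).map fun n => (q.1, p.2 - (n + 1 : ℕ))
  xs ++ ys

/-- **The rectilinear path through a list of corner points** (unit steps; first coordinate first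
between consecutive corners). [folklore] -/
def poly : List GridPoint → List GridPoint
  | [] => []
  | p :: ws => p :: go p ws
where
  /-- the tail of the path from `p` through the remaining corners -/
  go : GridPoint → List GridPoint → List GridPoint
  | _, [] => []
  | p, q :: ws => seg p q ++ go q ws

/-- The interior of a path: all points but the first and the last. [folklore] -/
def interior (l : List GridPoint) : List GridPoint := (l.drop 1).dropLast

/-- A point of the interior is a point of the path. [folklore] -/
theorem mem_of_mem_interior {l : List GridPoint} {p : GridPoint} (h : p ∈ interior l) : p ∈ l :=
  List.mem_of_mem_drop ((List.dropLast_subset _) h)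

/-- A point of a path is its head, its last point, or interior. [folklore] -/
theorem mem_interior_or {l : List GridPoint} {p : GridPoint} (h : p ∈ l) :
    l.head? = some p ∨ l.getLast? = some p ∨ p ∈ interior l := by
  unfold interior
  match l, h with
  | [a], h => left; simp_all
  | a :: b :: t, h =>
    rcases List.mem_cons.1 h with rfl | h
    · left; rfl
    · right
      simp only [List.drop_succ_cons, List.drop_zero, List.getLast?_cons_cons]
      have hmem : p ∈ (b :: t) := h
      rcases List.eq_nil_or_concat (b :: t) with hnil | ⟨L, x, hLx⟩
      · simp at hnil
      · rw [hLx] at hmem ⊢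
        rw [List.concat_eq_append] at hmem ⊢
        rw [List.getLast?_append, List.dropLast_concat]
        rcases List.mem_append.1 hmem with hm | hm
        · exact Or.inr hm
        · left; rw [List.mem_singleton.1 hm]; rfl

/-! ### Segments -/

/-- **The closed box spanned by two points** (for axis-parallel `a`, `b`: the segment `[a, b]`), as a
membership test. [folklore] -/
def inCseg (a b p : GridPoint) : Bool :=
  decide (min a.1 b.1 ≤ p.1) && decide (p.1 ≤ max a.1 b.1) && decide (min a.2 b.2 ≤ p.2) && decide (p.2 ≤ max a.2 b.2)

/-- `inCseg` as inequalities. [folklore] -/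
theorem inCseg_iff {a b p : GridPoint} :
    inCseg a b p = true ↔ min a.1 b.1 ≤ p.1 ∧ p.1 ≤ max a.1 b.1 ∧ min a.2 b.2 ≤ p.2 ∧ p.2 ≤ max a.2 b.2 := by
  simp [inCseg, and_assoc]

/-- The end points lie in their box. [folklore] -/
theorem inCseg_left (a b : GridPoint) : inCseg a b a = true := by
  rw [inCseg_iff]; exact ⟨min_le_left _ _, le_max_left _ _, min_le_left _ _, le_max_left _ _⟩

/-- The end points lie in their box. [folklore] -/
theorem inCseg_right (a b : GridPoint) : inCseg a b b = true := by
  rw [inCseg_iff]; exact ⟨min_le_right _ _, le_max_right _ _, min_le_right _ _, le_max_right _ _⟩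

/-- The points of `seg p q` lie in the box of `p` and `q`. [folklore] -/
theorem inCseg_of_mem_seg {p q r : GridPoint} (h : r ∈ seg p q) : inCseg p q r = true := by
  rw [inCseg_iff]
  unfold seg at h
  simp only [List.mem_append] at h
  rcases h with h | h
  · split_ifs at h with hx
    · obtain ⟨n, hn, rfl⟩ := List.mem_map.1 h
      have := List.mem_range.1 hn
      simp only; omega
    · obtain ⟨n, hn, rfl⟩ := List.mem_map.1 h
      have := List.mem_range.1 hn
      simp only; omega
  · split_ifs at h with hy
    · obtain ⟨n, hn, rfl⟩ := List.mem_map.1 h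
      have := List.mem_range.1 hn
      simp only; omega
    · obtain ⟨n, hn, rfl⟩ := List.mem_map.1 h
      have := List.mem_range.1 hn
      simp only; omega

/-- **Every point of a rectilinear path lies on the box of two consecutive corners** (or is the only
corner). [folklore] -/
theorem mem_poly_exists {ws : List GridPoint} {p : GridPoint} (h : p ∈ poly ws) :
    (∃ a b, [a, b] <:+: ws ∧ inCseg a b p = true) ∨ ws = [p] := by
  have hgo : ∀ (ws' : List GridPoint) (c : GridPoint), p ∈ poly.go c ws' →
      ∃ a b, [a, b] <:+: (c :: ws') ∧ inCseg a b p = true := by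
    intro ws'
    induction ws' with
    | nil => intro c hc; simp [poly.go] at hc
    | cons q ws' ih =>
      intro c hc
      simp only [poly.go, List.mem_append] at hc
      rcases hc with hc | hc
      · exact ⟨c, q, ⟨[], ws', rfl⟩, inCseg_of_mem_seg hc⟩
      · obtain ⟨a, b, hab, hin⟩ := ih q hc
        exact ⟨a, b, hab.trans (List.suffix_cons _ _).isInfix, hin⟩
  cases ws with
  | nil => simp [poly] at h
  | cons c ws' =>
    simp only [poly, List.mem_cons] at h
    rcases h with rfl | h
    · cases ws' with
      | nil => exact Or.inr rfl
      | cons q ws'' => exact Or.inl ⟨p, q, ⟨[], ws'', rfl⟩, inCseg_left _ _⟩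
    · exact Or.inl (hgo ws' c h)

/-- **Two boxes meet only inside `E`**: every lattice point of both boxes is listed in `E` (tested on
the intersection box, which must be at most `3 × 3` unless empty). [folklore] -/
def csegMeetB (a b c d : GridPoint) (E : List GridPoint) : Bool :=
  let x₀ := max (min a.1 b.1) (min c.1 d.1)
  let x₁ := min (max a.1 b.1) (max c.1 d.1)
  let y₀ := max (min a.2 b.2) (min c.2 d.2)
  let y₁ := min (max a.2 b.2) (max c.2 d.2)
  decide (x₁ < x₀) || decide (y₁ < y₀) ||
    (decide (x₁ - x₀ ≤ 2) && decide (y₁ - y₀ ≤ 2) &&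
      (List.range 3).all fun i => (List.range 3).all fun j =>
        decide (x₁ < x₀ + i) || decide (y₁ < y₀ + j) || E.contains (x₀ + i, y₀ + j))

/-- **Soundness of `csegMeetB`**: a common point of the two boxes is listed. [folklore] -/
theorem csegMeet_sub {a b c d : GridPoint} {E : List GridPoint} (h : csegMeetB a b c d E = true)
    {p : GridPoint} (h₁ : inCseg a b p = true) (h₂ : inCseg c d p = true) : p ∈ E := by
  rw [inCseg_iff] at h₁ h₂
  simp only [csegMeetB, Bool.or_eq_true, decide_eq_true_eq, Bool.and_eq_true, List.all_eq_true, List.mem_range,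
    List.contains_iff_mem] at h
  rcases h with (h | h) | ⟨⟨hx, hy⟩, hall⟩
  · omega
  · omega
  · have hi : (p.1 - max (min a.1 b.1) (min c.1 d.1)).toNat < 3 := by omega
    have hj : (p.2 - max (min a.2 b.2) (min c.2 d.2)).toNat < 3 := by omega
    have := hall _ hi _ hj
    rcases this with (h' | h') | h'
    · omega
    · omega
    · have e1 : max (min a.1 b.1) (min c.1 d.1) + ((p.1 - max (min a.1 b.1) (min c.1 d.1)).toNat : ℤ) = p.1 := by omega
      have e2 : max (min a.2 b.2) (min c.2 d.2) + ((p.2 - max (min a.2 b.2) (min c.2 d.2)).toNat : ℤ) = p.2 := by omega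
      rw [e1, e2] at h'
      exact h'

/-! ### Translation -/

/-- Translating a point. [folklore] -/
def shiftPt (v p : GridPoint) : GridPoint := (p.1 + v.1, p.2 + v.2)

/-- `shiftPt` is `SDrawing.shift`. [folklore] -/
theorem shiftPt_eq (v p : GridPoint) : shiftPt v p = SDrawing.shift v p := rfl

/-- Translation is injective. [folklore] -/
theorem shiftPt_injective (v : GridPoint) : Function.Injective (shiftPt v) := fun p q h => by
  simp only [shiftPt, Prod.mk.injEq] at h; exact Prod.ext (by omega) (by omega)

/-- Zero translation. [folklore] -/
@[simp] theorem shiftPt_zero (p : GridPoint) : shiftPt (0, 0) p = p := by simp [shiftPt]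

/-- Composing translations. [folklore] -/
theorem shiftPt_shiftPt (u v p : GridPoint) : shiftPt u (shiftPt v p) = shiftPt (u.1 + v.1, u.2 + v.2) p := by
  simp only [shiftPt, Prod.mk.injEq]; omega

/-! ### Bounding boxes -/

/-- A point lies in the box `[x₀, x₁] × [y₀, y₁]`. [folklore] -/
def inBoxB (x₀ x₁ y₀ y₁ : ℤ) (p : GridPoint) : Bool :=
  decide (x₀ ≤ p.1) && decide (p.1 ≤ x₁) && decide (y₀ ≤ p.2) && decide (p.2 ≤ y₁)

/-- `inBoxB` as inequalities. [folklore] -/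
theorem inBoxB_iff {x₀ x₁ y₀ y₁ : ℤ} {p : GridPoint} :
    inBoxB x₀ x₁ y₀ y₁ p = true ↔ x₀ ≤ p.1 ∧ p.1 ≤ x₁ ∧ y₀ ≤ p.2 ∧ p.2 ≤ y₁ := by
  simp [inBoxB, and_assoc]

/-! ### Points of a segment, self-avoidance and the grid-path property of rectilinear paths -/

/-- **The points of `seg p q`**: first along the row of `p` (excluding `p`, up to the column of `q`),
then along the column of `q` (excluding the row of `p`, up to `q`). [folklore] -/
theorem mem_seg_iff {p q r : GridPoint} : r ∈ seg p q ↔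
    (r.2 = p.2 ∧ ((p.1 < r.1 ∧ r.1 ≤ q.1) ∨ (q.1 ≤ r.1 ∧ r.1 < p.1))) ∨
    (r.1 = q.1 ∧ ((p.2 < r.2 ∧ r.2 ≤ q.2) ∨ (q.2 ≤ r.2 ∧ r.2 < p.2))) := by
  obtain ⟨r₁, r₂⟩ := r
  unfold seg
  simp only [List.mem_append]
  constructor
  · rintro (h | h)
    · left
      split_ifs at h with hx <;>
      · obtain ⟨n, hn, hh⟩ := List.mem_map.1 h
        rw [List.mem_range] at hn
        simp only [Prod.mk.injEq] at hh
        omega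
    · right
      split_ifs at h with hy <;>
      · obtain ⟨n, hn, hh⟩ := List.mem_map.1 h
        rw [List.mem_range] at hn
        simp only [Prod.mk.injEq] at hh
        omega
  · rintro (⟨h2, h1⟩ | ⟨h1, h2⟩)
    · left
      split_ifs with hx
      · exact List.mem_map.2 ⟨(r₁ - p.1 - 1).toNat, List.mem_range.2 (by omega), Prod.ext (by simp only; omega) (by simp only; omega)⟩
      · exact List.mem_map.2 ⟨(p.1 - r₁ - 1).toNat, List.mem_range.2 (by omega), Prod.ext (by simp only; omega) (by simp only; omega)⟩
    · right
      split_ifs with hy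
      · exact List.mem_map.2 ⟨(r₂ - p.2 - 1).toNat, List.mem_range.2 (by omega), Prod.ext (by simp only; omega) (by simp only; omega)⟩
      · exact List.mem_map.2 ⟨(p.2 - r₂ - 1).toNat, List.mem_range.2 (by omega), Prod.ext (by simp only; omega) (by simp only; omega)⟩

/-- A segment does not revisit a point. [folklore] -/
theorem nodup_seg (p q : GridPoint) : (seg p q).Nodup := by
  unfold seg
  refine List.Nodup.append ?_ ?_ ?_
  · split_ifs <;> exact List.nodup_range.map_on fun a _ b _ h => by simp only [Prod.mk.injEq] at h; omega
  · split_ifs <;> exact List.nodup_range.map_on fun a _ b _ h => by simp only [Prod.mk.injEq] at h; omega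
  · intro r h1 h2
    split_ifs at h1 h2 <;>
    · obtain ⟨n, -, rfl⟩ := List.mem_map.1 h1
      obtain ⟨m, -, h⟩ := List.mem_map.1 h2
      simp only [Prod.mk.injEq] at h
      omega

/-- The start of a segment is not one of its points. [folklore] -/
theorem start_notMem_seg (p q : GridPoint) : p ∉ seg p q := by
  rw [mem_seg_iff]; omega

/-- A segment is empty exactly when its ends coincide. [folklore] -/
theorem seg_eq_nil_iff {p q : GridPoint} : seg p q = [] ↔ p = q := by
  constructor
  · intro h
    by_contra hne
    have key : ∃ r, r ∈ seg p q := by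
      by_cases h1 : p.1 = q.1
      · have h2 : p.2 ≠ q.2 := fun h2 => hne (Prod.ext h1 h2)
        rcases lt_or_gt_of_ne h2 with hl | hg
        · exact ⟨(q.1, p.2 + 1), by rw [mem_seg_iff]; exact Or.inr ⟨rfl, Or.inl ⟨by simp only; omega, by simp only; omega⟩⟩⟩
        · exact ⟨(q.1, p.2 - 1), by rw [mem_seg_iff]; exact Or.inr ⟨rfl, Or.inr ⟨by simp only; omega, by simp only; omega⟩⟩⟩
      · rcases lt_or_gt_of_ne h1 with hl | hg
        · exact ⟨(p.1 + 1, p.2), by rw [mem_seg_iff]; exact Or.inl ⟨rfl, Or.inl ⟨by simp only; omega, by simp only; omega⟩⟩⟩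
        · exact ⟨(p.1 - 1, p.2), by rw [mem_seg_iff]; exact Or.inl ⟨rfl, Or.inr ⟨by simp only; omega, by simp only; omega⟩⟩⟩
    obtain ⟨r, hr⟩ := key
    rw [h] at hr; simp at hr
  · rintro rfl; simp [seg]

/-- The last point of a nonempty segment is its target. [folklore] -/
theorem getLast_seg {p q : GridPoint} (h : seg p q ≠ []) : (seg p q).getLast h = q := by
  -- the last point is a point of the segment after which nothing comes: characterise it arithmetically
  have hmem : (seg p q).getLast h ∈ seg p q := List.getLast_mem h
  -- `q` is the last element of the vertical part, or of the horizontal part if there is none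
  obtain ⟨q₁, q₂⟩ := q
  unfold seg at h hmem ⊢
  by_cases hy : p.2 = q₂
  · subst hy
    have e0 : (p.2 - p.2).toNat = 0 := by simp
    simp only [le_refl, ↓reduceIte, e0, List.range_zero, List.map_nil, List.append_nil] at h hmem ⊢
    split_ifs at h ⊢ with hx
    · rw [List.getLast_map, List.getLast_range]
      refine Prod.ext ?_ rfl
      have hpos : 0 < (q₁ - p.1).toNat := by
        rw [Nat.pos_iff_ne_zero]; intro h0; apply h; simp [h0]
      simp only; push_cast; omega
    · rw [List.getLast_map, List.getLast_range]
      refine Prod.ext ?_ rfl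
      have hpos : 0 < (p.1 - q₁).toNat := by
        rw [Nat.pos_iff_ne_zero]; intro h0; apply h; simp [h0]
      simp only; push_cast; omega
  · have hne : (if p.2 ≤ q₂ then (List.range (q₂ - p.2).toNat).map (fun n => (q₁, p.2 + ((n + 1 : ℕ) : ℤ)))
        else (List.range (p.2 - q₂).toNat).map (fun n => (q₁, p.2 - ((n + 1 : ℕ) : ℤ)))) ≠ [] := by
      split_ifs with hle <;> simp <;> omega
    rw [List.getLast_append_of_ne_nil _ hne]
    split_ifs at hne ⊢ with hle
    · rw [List.getLast_map, List.getLast_range]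
      refine Prod.ext rfl ?_
      have hpos : 0 < (q₂ - p.2).toNat := by omega
      simp only; push_cast; omega
    · rw [List.getLast_map, List.getLast_range]
      refine Prod.ext rfl ?_
      have hpos : 0 < (p.2 - q₂).toNat := by omega
      simp only; push_cast; omega

/-- A progression of unit steps from `a` is a grid path. [folklore] -/
theorem isChain_cons_map_range (f : ℕ → GridPoint) (a : GridPoint) (n : ℕ) (h0 : IsGridEdge a (f 0))
    (hs : ∀ k, IsGridEdge (f k) (f (k + 1))) : List.IsChain IsGridEdge (a :: (List.range n).map f) := by
  induction n generalizing a f with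
  | zero => simp
  | succ n ih =>
    rw [List.range_succ_eq_map, List.map_cons, List.map_map]
    exact List.isChain_cons_cons.2 ⟨h0, ih (f ∘ Nat.succ) (f 0) (hs 0) fun k => hs (k + 1)⟩

/-- A segment, started at its origin, is a grid path. [folklore] -/
theorem isChain_cons_seg (p q : GridPoint) : List.IsChain IsGridEdge (p :: seg p q) := by
  unfold seg
  generalize hx : (if p.1 ≤ q.1 then (List.range (q.1 - p.1).toNat).map (fun n => (p.1 + ((n + 1 : ℕ) : ℤ), p.2))
      else (List.range (p.1 - q.1).toNat).map (fun n => (p.1 - ((n + 1 : ℕ) : ℤ), p.2))) = xs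
  generalize hy : (if p.2 ≤ q.2 then (List.range (q.2 - p.2).toNat).map (fun n => (q.1, p.2 + ((n + 1 : ℕ) : ℤ)))
      else (List.range (p.2 - q.2).toNat).map (fun n => (q.1, p.2 - ((n + 1 : ℕ) : ℤ)))) = ys
  have hxs : List.IsChain IsGridEdge (p :: xs) := by
    rw [← hx]
    split_ifs with h
    · exact isChain_cons_map_range _ _ _ (by unfold IsGridEdge; simp) (fun k => by unfold IsGridEdge; simp)
    · exact isChain_cons_map_range _ _ _ (by unfold IsGridEdge; simp) (fun k => by unfold IsGridEdge; right; simp)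
  have hlast : (p :: xs).getLast (by simp) = (q.1, p.2) := by
    -- the last element of an arithmetic progression
    have last_prog : ∀ (f : ℕ → GridPoint) (n : ℕ), (p :: (List.range n).map f).getLast (by simp) = if n = 0 then p else f (n - 1) := by
      intro f n
      cases n with
      | zero => simp
      | succ n =>
        rw [List.getLast_cons (by simp), List.getLast_map, List.getLast_range]
        simp
    rw [← hx]
    split_ifs with h
    · rw [last_prog]
      split_ifs with h0
      · exact Prod.ext (by simp only; omega) rfl
      · refine Prod.ext ?_ rfl
        simp only
        have : (((q.1 - p.1).toNat - 1 : ℕ) : ℤ) = q.1 - p.1 - 1 := by omega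
        push_cast; omega
    · rw [last_prog]
      split_ifs with h0
      · exact Prod.ext (by simp only; omega) rfl
      · refine Prod.ext ?_ rfl
        simp only
        push_cast; omega
  have hys : List.IsChain IsGridEdge ((q.1, p.2) :: ys) := by
    rw [← hy]
    split_ifs with h
    · exact isChain_cons_map_range _ _ _ (by unfold IsGridEdge; simp) (fun k => by unfold IsGridEdge; simp)
    · exact isChain_cons_map_range _ _ _ (by unfold IsGridEdge; simp) (fun k => by unfold IsGridEdge; left; simp)
  have := List.IsChain.append hxs hys.tail ?_
  · simpa using this
  · intro x hx' y hy'
    rw [List.getLast?_eq_some_getLast (by simp), Option.mem_def, Option.some.injEq] at hx'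
    rw [hlast] at hx'
    subst hx'
    cases ys with
    | nil => simp at hy'
    | cons z zs =>
      simp only [List.tail_cons, List.head?_cons, Option.mem_def, Option.some.injEq] at hy'
      subst hy'
      exact hys.rel

/-- **A rectilinear path is a grid path.** [folklore] -/
theorem isChain_poly (ws : List GridPoint) : List.IsChain IsGridEdge (poly ws) := by
  suffices h : ∀ (ws' : List GridPoint) (c : GridPoint), List.IsChain IsGridEdge (c :: poly.go c ws') by
    cases ws with
    | nil => simp [poly]
    | cons c ws' => exact h ws' c
  intro ws'
  induction ws' with
  | nil => intro c; simp [poly.go]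
  | cons q ws' ih =>
    intro c
    simp only [poly.go]
    by_cases hs : seg c q = []
    · rw [hs, List.nil_append, seg_eq_nil_iff.1 hs]; exact ih q
    · rw [← List.cons_append]
      refine List.IsChain.append (isChain_cons_seg c q) (ih q).tail fun x hx y hy => ?_
      rw [List.getLast?_eq_some_getLast (by simp), Option.mem_def, Option.some.injEq, List.getLast_cons hs, getLast_seg hs] at hx
      subst hx
      have h2 := ih q
      cases hgo : poly.go q ws' with
      | nil => rw [hgo] at hy; simp at hy
      | cons z zs =>
        rw [hgo] at hy h2
        simp only [List.head?_cons, Option.mem_def, Option.some.injEq] at hy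
        subst hy
        exact h2.rel

/-- **Self-avoidance of a rectilinear path, one corner at a time**: if the path from `q` on is
self-avoiding, does not contain `p`, and meets the segment from `p` to `q` only at `q`, then the
path from `p` is self-avoiding. [folklore] -/
theorem nodup_poly_cons {p q : GridPoint} {ws : List GridPoint} (h1 : (poly (q :: ws)).Nodup)
    (h2 : ∀ r ∈ seg p q, r ∈ poly (q :: ws) → r = q) (h3 : p ∉ poly (q :: ws)) :
    (poly (p :: q :: ws)).Nodup := by
  have e1 : poly (p :: q :: ws) = p :: (seg p q ++ poly.go q ws) := rfl
  have e2 : poly (q :: ws) = q :: poly.go q ws := rfl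
  rw [e2] at h1 h2 h3
  rw [e1, List.nodup_cons, List.mem_append, not_or]
  obtain ⟨hq, hgo⟩ := List.nodup_cons.1 h1
  refine ⟨⟨start_notMem_seg p q, fun h => h3 (List.mem_cons_of_mem _ h)⟩, ?_⟩
  refine List.Nodup.append (nodup_seg p q) hgo fun r hr hr' => ?_
  have := h2 r hr (List.mem_cons_of_mem _ hr')
  subst this
  exact hq hr'

/-- The points of the path from `q` after `q` lie on the boxes of later consecutive corners.
[folklore] -/
theorem mem_poly_tail {q r : GridPoint} {ws : List GridPoint} (h : r ∈ poly (q :: ws)) (hne : r ≠ q) :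
    ∃ a b, [a, b] <:+: (q :: ws) ∧ inCseg a b r = true := by
  rcases mem_poly_exists h with h' | h'
  · exact h'
  · simp only [List.cons.injEq] at h'; exact absurd h'.1.symm hne

end Literature.Barriers.CriticalPhenomena.GridSAW.FormulaDrawing
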